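import Literature.NumberTheory.LFunctions.ConreyIwaniec2002ThetaVoronoiDefs
import Literature.Analysis.FunctionSpaces.BesselJZeroSqrtLaplace
import Mathlib.Analysis.SpecialFunctions.Exp
import HarnessLib

/-!
# Conrey–Iwaniec (2002), Proposition 3.1 at weight one for exponential test functions

B. Conrey, H. Iwaniec, *Spacing of zeros of Hecke L-functions and the class number problem*,
Acta Arith. 103 (2002), §3, (3.3)–(3.4) and Proposition 3.1 (3.11)–(3.13)
[held text `paper:arxiv-math_0111012`, p0008].

For the cell `landau-siegel/ls-inputs` (sub-line `theta-voronoi`, registered stub V2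
`stub_hecke_voronoi : HeckeVoronoiWeightOne`). Print derives (3.11) from the `ω`-relation (3.4)
by Mellin transforms, the functional equation (3.9) and the Mellin–Barnes integral (3.12)–(3.13)
for `J₀`. Here we record the observation that for the test function `g(x) = e^{-px}` (`p > 0`)
the relation (3.4) at the height `y = 2π/(Cp)` **is** the summation formula, term by term:
`∫₀^∞ e^{-px}dx = 1/p` and `∫₀^∞ e^{-px}J₀((4π/C)√(nx))dx = e^{-4π²n/(C²p)}/p` (Weber's exponential
integral, `integral_exp_neg_mul_besselJ_zero_sqrt`), so that

`a₀ + Σ_{n≥1} a(n)e(nx_A)e^{-pn} = (2πiη/C){b₀∫₀^∞e^{-px}dx + Σ_{n≥1} b(n)e(nx_B)∫₀^∞e^{-px}J₀((4π/C)√(nx))dx}`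

(`voronoi_hasSum_exp`; the constant term `a₀ = a₀·g(0)` is the term print's (3.11) omits because
its test functions vanish at `0`). By linearity the same holds for every exponential polynomial
`Σ_k w_k e^{-p_k x}` (`voronoi_hasSum_expPoly`). The companion file
`ConreyIwaniec2002HeckeVoronoi.lean` passes to `C²` test functions compactly supported in `(0,∞)`
by weighted density (`exists_expPoly_approx`) and the Bessel decay bound, proving
`HeckeVoronoiWeightOne`.

No definitions. «The programme SEARCHES and TYPES; no claim about Landau–Siegel zeros until a
kernel theorem says so.»
-/

noncomputable section

open scoped Topology FourierTransform
open Filter Set MeasureTheory Complex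

namespace Literature.NumberTheory.LFunctions

namespace ConreyIwaniec2002

open Literature.Analysis.FunctionSpaces

/-! ## Elementary bounds -/

/-- `‖e(x)‖ = 1`. [folklore] -/
private theorem norm_fourierChar (x : ℝ) : ‖((𝐞 x : Circle) : ℂ)‖ = 1 := Circle.norm_coe _

/-- Divisor-boundedness `|a(n)| ≤ Mτ(n)` (print: `a_n ≪ n^{k-1+ε}`, (3.10), (6.42)) forces `M ≥ 0`
(take `n = 1`). [cite: ConreyIwaniec2002, §3 (3.10)] -/
theorem divisorBound_nonneg {M : ℝ} {lam : ℕ → ℂ}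
    (h : ∀ n : ℕ, ‖lam n‖ ≤ M * (Nat.divisors n).card) : 0 ≤ M := by
  have := h 1
  simp only [Nat.divisors_one, Finset.card_singleton, Nat.cast_one, mul_one] at this
  exact (norm_nonneg _).trans this

/-- `|a(n)| ≤ Mτ(n) ≤ Mn`. [folklore] -/
private theorem norm_le_mul_self {M : ℝ} {lam : ℕ → ℂ}
    (h : ∀ n : ℕ, ‖lam n‖ ≤ M * (Nat.divisors n).card) (n : ℕ) : ‖lam n‖ ≤ M * n :=
  (h n).trans (mul_le_mul_of_nonneg_left (by exact_mod_cast Nat.card_divisors_le_self n)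
    (divisorBound_nonneg h))

/-- The terms `a(n+1)e((n+1)x)e^{-p(n+1)}` are summable for `p > 0` when `|a(n)| ≤ Mτ(n)`
(domination by `M(n+1)e^{-p(n+1)}`) — the absolute convergence of the `q`-series (3.1)–(3.2) in the
upper half plane. [cite: ConreyIwaniec2002, §3 (3.1)–(3.2)] -/
theorem summable_twisted_exp {M : ℝ} {lam : ℕ → ℂ}
    (h : ∀ n : ℕ, ‖lam n‖ ≤ M * (Nat.divisors n).card) (x : ℝ) {p : ℝ} (hp : 0 < p) :
    Summable (fun n : ℕ => lam (n + 1) * ((𝐞 (((n : ℝ) + 1) * x) : Circle) : ℂ) *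
      ((Real.exp (-(p * ((n : ℝ) + 1))) : ℝ) : ℂ)) := by
  have hs : Summable (fun n : ℕ => M * ((((n + 1 : ℕ) : ℝ)) ^ 1 * Real.exp (-p * ((n + 1 : ℕ) : ℝ)))) :=
    ((summable_nat_add_iff 1).mpr (Real.summable_pow_mul_exp_neg_nat_mul 1 hp)).mul_left M
  refine Summable.of_norm_bounded hs fun n => ?_
  rw [norm_mul, norm_mul, norm_fourierChar, mul_one, Complex.norm_real,
    Real.norm_of_nonneg (Real.exp_pos _).le]
  have h1 := norm_le_mul_self h (n + 1)
  push_cast at h1 ⊢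
  rw [pow_one, show -p * ((n : ℝ) + 1) = -(p * ((n : ℝ) + 1)) by ring, ← mul_assoc]
  exact mul_le_mul_of_nonneg_right h1 (Real.exp_pos _).le

/-! ## The relation (3.4) at `y = 2π/(Cp)` -/

/-- **(3.4) for the test function `e^{-px}`**: if `(iy)⁻¹A(x_A + i/(Cy)) = ηB(x_B + iy/C)` for all
`y > 0`, then for `p > 0` (take `y = 2π/(Cp)`):
`a₀ + Σ_{n≥1}a(n)e(nx_A)e^{-pn} = (2πiη/(Cp))·(b₀ + Σ_{n≥1}b(n)e(nx_B)e^{-4π²n/(C²p)})`.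
[cite: ConreyIwaniec2002, §3 (3.4)] -/
theorem omegaRelated_exp {C : ℝ} (hC : 0 < C) {η : ℂ} {lamA lamB : ℕ → ℂ} {a₀ b₀ : ℂ} {xA xB : ℝ}
    (hrel : IsOmegaRelated C η lamA lamB a₀ b₀ xA xB) {p : ℝ} (hp : 0 < p) :
    a₀ + ∑' n : ℕ, lamA (n + 1) * ((𝐞 (((n : ℝ) + 1) * xA) : Circle) : ℂ) *
        ((Real.exp (-(p * ((n : ℝ) + 1))) : ℝ) : ℂ) =
      (2 * Real.pi * I * η / (C * p)) *
        (b₀ + ∑' n : ℕ, lamB (n + 1) * ((𝐞 (((n : ℝ) + 1) * xB) : Circle) : ℂ) *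
          ((Real.exp (-(4 * Real.pi ^ 2 * ((n : ℝ) + 1) / (C ^ 2 * p))) : ℝ) : ℂ)) := by
  set y : ℝ := 2 * Real.pi / (C * p) with hy
  have hy0 : 0 < y := by positivity
  have h := hrel y hy0
  -- rewrite the two `q`-series
  have hA : thetaValue lamA a₀ xA (1 / (C * y)) = a₀ + ∑' n : ℕ, lamA (n + 1) *
      ((𝐞 (((n : ℝ) + 1) * xA) : Circle) : ℂ) * ((Real.exp (-(p * ((n : ℝ) + 1))) : ℝ) : ℂ) := by
    unfold thetaValue
    congr 1
    refine tsum_congr fun n => ?_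
    congr 3
    rw [hy]; field_simp
  have hB : thetaValue lamB b₀ xB (y / C) = b₀ + ∑' n : ℕ, lamB (n + 1) *
      ((𝐞 (((n : ℝ) + 1) * xB) : Circle) : ℂ) *
        ((Real.exp (-(4 * Real.pi ^ 2 * ((n : ℝ) + 1) / (C ^ 2 * p))) : ℝ) : ℂ) := by
    unfold thetaValue
    congr 1
    refine tsum_congr fun n => ?_
    congr 3
    rw [hy]; field_simp; ring
  rw [hA, hB] at h
  have hIy : (I * y : ℂ) ≠ 0 := mul_ne_zero I_ne_zero (by exact_mod_cast hy0.ne')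
  have h2 := congrArg (fun z => (I * y : ℂ) * z) h
  simp only [← mul_assoc, mul_inv_cancel₀ hIy, one_mul] at h2
  rw [h2]
  congr 1
  rw [hy]
  push_cast
  field_simp

/-! ## The kernel `J₀((4π/c)√(mx/r))` and the Laplace transforms of `e^{-px}` -/

/-- `(4π/c)√(mx/r) = ((4π/c)√(m/r))·√x`, so `ciBesselKernel (fun _ ↦ r) c m x = J₀(β_m√x)` with
`β_m = (4π/c)√(m/r)`. [cite: ConreyIwaniec2002, §3 (3.14)] -/
theorem ciBesselKernel_const_eq (r c m : ℕ) (x : ℝ) :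
    ciBesselKernel (fun _ ↦ r) c m x =
      ((besselJ 0 ((4 * Real.pi / c * Real.sqrt ((m : ℝ) / r)) * Real.sqrt x) : ℝ) : ℂ) := by
  unfold ciBesselKernel
  congr 2
  rw [show (m : ℝ) * x / (r : ℝ) = (m : ℝ) / r * x by ring, Real.sqrt_mul (by positivity)]
  ring

/-- `∫₀^∞ e^{-px} dx = 1/p` (complex-valued). [folklore] -/
private theorem integral_exp_neg_mul_Ioi_complex {p : ℝ} (hp : 0 < p) :
    ∫ x in Ioi (0 : ℝ), ((Real.exp (-(p * x)) : ℝ) : ℂ) = ((1 / p : ℝ) : ℂ) := by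
  rw [integral_complex_ofReal]
  congr 1
  have h := integral_exp_mul_Ioi (a := -p) (by linarith) 0
  simp only [mul_zero, Real.exp_zero, neg_mul] at h
  rw [h, neg_div_neg_eq]

/-- `e^{-px}` is integrable on `(0,∞)` (complex-valued; convergence of Euler's integral at `z = 1`).
[cite: DLMF, 5.2.1] -/
theorem integrableOn_exp_neg_mul_Ioi_complex {p : ℝ} (hp : 0 < p) :
    IntegrableOn (fun x : ℝ => ((Real.exp (-(p * x)) : ℝ) : ℂ)) (Ioi 0) := by
  have h := exp_neg_integrableOn_Ioi 0 hp
  have h2 : IntegrableOn (fun x : ℝ => Real.exp (-(p * x))) (Ioi 0) := by simpa only [neg_mul] using h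
  exact h2.ofReal

/-- **The Hankel-type transform of `e^{-px}` against the weight-one kernel**:
`∫₀^∞ e^{-px}J₀((4π/c)√(mx/r))dx = e^{-4π²m/(c²r·p)}/p` (Weber's exponential integral with
`β² = 16π²m/(c²r)`). [cite: Watson1944, §13.3 (1)] -/
theorem integral_exp_mul_ciBesselKernel {c r : ℕ} (hc : 1 ≤ c) (hr : 1 ≤ r) (m : ℕ) {p : ℝ}
    (hp : 0 < p) :
    ∫ x in Ioi (0 : ℝ), ((Real.exp (-(p * x)) : ℝ) : ℂ) * ciBesselKernel (fun _ ↦ r) c m x =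
      ((Real.exp (-(4 * Real.pi ^ 2 * m / (((c : ℝ) * Real.sqrt r) ^ 2 * p))) / p : ℝ) : ℂ) := by
  simp_rw [ciBesselKernel_const_eq]
  rw [integral_exp_neg_mul_besselJ_zero_sqrt_complex hp]
  have hc0 : (0 : ℝ) < c := by exact_mod_cast hc
  have hr0 : (0 : ℝ) < r := by exact_mod_cast hr
  congr 4
  have h1 : Real.sqrt ((m : ℝ) / r) ^ 2 = (m : ℝ) / r := Real.sq_sqrt (by positivity)
  have h2 : Real.sqrt (r : ℝ) ^ 2 = r := Real.sq_sqrt hr0.le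
  simp only [mul_pow, div_pow, h1, h2]
  field_simp

/-- `e^{-px}J₀((4π/c)√(mx/r))` is integrable on `(0,∞)`. [cite: Watson1944, §13.3 (1)] -/
theorem integrableOn_exp_mul_ciBesselKernel (r c m : ℕ) {p : ℝ} (hp : 0 < p) :
    IntegrableOn (fun x : ℝ => ((Real.exp (-(p * x)) : ℝ) : ℂ) * ciBesselKernel (fun _ ↦ r) c m x)
      (Ioi 0) := by
  simp_rw [ciBesselKernel_const_eq]
  have h : IntegrableOn (fun x : ℝ => ((Real.exp (-(p * x)) *
      besselJ 0 ((4 * Real.pi / c * Real.sqrt ((m : ℝ) / r)) * Real.sqrt x) : ℝ) : ℂ)) (Ioi 0) :=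
    (integrableOn_exp_neg_mul_besselJ_zero_sqrt hp
      (4 * Real.pi / c * Real.sqrt ((m : ℝ) / r))).ofReal
  refine h.congr_fun (fun x _ => ?_) measurableSet_Ioi
  push_cast
  ring

/-! ## Proposition 3.1 at weight one for `e^{-px}` and for exponential polynomials -/

/-- The dual series of `e^{-px}`: its terms `b(m+1)e((m+1)x_B)e^{-4π²(m+1)/(C²p)}` are summable.
[folklore] -/
private theorem summable_dual_exp {M : ℝ} {lamB : ℕ → ℂ}
    (hB : ∀ n : ℕ, ‖lamB n‖ ≤ M * (Nat.divisors n).card) (xB : ℝ) {C p : ℝ} (hC : 0 < C)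
    (hp : 0 < p) :
    Summable (fun n : ℕ => lamB (n + 1) * ((𝐞 (((n : ℝ) + 1) * xB) : Circle) : ℂ) *
      ((Real.exp (-(4 * Real.pi ^ 2 * ((n : ℝ) + 1) / (C ^ 2 * p))) : ℝ) : ℂ)) := by
  have h := summable_twisted_exp hB xB (p := 4 * Real.pi ^ 2 / (C ^ 2 * p)) (by positivity)
  refine h.congr fun n => ?_
  congr 3
  ring

/-- **Proposition 3.1 at weight one for the test function `g(x) = e^{-px}`, `p > 0`** (with the
constant term `a₀g(0) = a₀` kept): under the `ω`-relation (3.4) with `C = c√r`,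
`Σ_m (2πiη/C)b(m+1)e((m+1)x_B)∫₀^∞e^{-px}J₀((4π/c)√((m+1)x/r))dx`
`= a₀ + Σ_{n≥1}a(n)e(nx_A)e^{-pn} − (2πiη/C)b₀∫₀^∞e^{-px}dx`.
[cite: ConreyIwaniec2002, Proposition 3.1 (3.11)] -/
theorem voronoi_hasSum_exp {c r : ℕ} (hc : 1 ≤ c) (hr : 1 ≤ r) {η : ℂ} {M : ℝ}
    {lamA lamB : ℕ → ℂ} (hB : ∀ n : ℕ, ‖lamB n‖ ≤ M * (Nat.divisors n).card)
    {a₀ b₀ : ℂ} {xA xB : ℝ}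
    (hrel : IsOmegaRelated ((c : ℝ) * Real.sqrt r) η lamA lamB a₀ b₀ xA xB) {p : ℝ} (hp : 0 < p) :
    HasSum
      (fun m : ℕ ↦ (2 * Real.pi * I * η / ((c : ℝ) * Real.sqrt r)) * lamB (m + 1) *
        ((𝐞 (((m : ℝ) + 1) * xB) : Circle) : ℂ) *
        ∫ x in Ioi (0 : ℝ), ((Real.exp (-(p * x)) : ℝ) : ℂ) * ciBesselKernel (fun _ ↦ r) c (m + 1) x)
      (a₀ * ((Real.exp (-(p * 0)) : ℝ) : ℂ) +
        (∑' n : ℕ, lamA (n + 1) * ((𝐞 (((n : ℝ) + 1) * xA) : Circle) : ℂ) *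
          ((Real.exp (-(p * ((n : ℝ) + 1))) : ℝ) : ℂ)) -
        (2 * Real.pi * I * η / ((c : ℝ) * Real.sqrt r)) * b₀ *
          ∫ x in Ioi (0 : ℝ), ((Real.exp (-(p * x)) : ℝ) : ℂ)) := by
  have hc0 : (0 : ℝ) < c := by exact_mod_cast hc
  have hr0 : (0 : ℝ) < r := by exact_mod_cast hr
  have hC : 0 < (c : ℝ) * Real.sqrt r := by positivity
  have hsum := summable_dual_exp hB xB hC hp
  have hkey := omegaRelated_exp hC hrel hp
  -- the dual series of `e^{-px}`, summed
  have h1 : HasSum (fun m : ℕ ↦ (2 * Real.pi * I * η / (((c : ℝ) * Real.sqrt r) * p)) * (lamB (m + 1) *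
      ((𝐞 (((m : ℝ) + 1) * xB) : Circle) : ℂ) *
        ((Real.exp (-(4 * Real.pi ^ 2 * ((m : ℝ) + 1) / (((c : ℝ) * Real.sqrt r) ^ 2 * p))) : ℝ) : ℂ)))
      ((2 * Real.pi * I * η / (((c : ℝ) * Real.sqrt r) * p)) * ∑' n : ℕ, lamB (n + 1) *
        ((𝐞 (((n : ℝ) + 1) * xB) : Circle) : ℂ) *
          ((Real.exp (-(4 * Real.pi ^ 2 * ((n : ℝ) + 1) / (((c : ℝ) * Real.sqrt r) ^ 2 * p))) : ℝ) : ℂ)) :=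
    hsum.hasSum.mul_left _
  have hp0 : (p : ℂ) ≠ 0 := by exact_mod_cast hp.ne'
  have hcc : (c : ℂ) ≠ 0 := by exact_mod_cast hc0.ne'
  have hrc : ((Real.sqrt r : ℝ) : ℂ) ≠ 0 := by exact_mod_cast (Real.sqrt_pos.mpr hr0).ne'
  convert h1 using 1
  · funext m
    rw [integral_exp_mul_ciBesselKernel hc hr (m + 1) hp]
    push_cast
    field_simp
  · set TB : ℂ := ∑' n : ℕ, lamB (n + 1) * ((𝐞 (((n : ℝ) + 1) * xB) : Circle) : ℂ) *
      ((Real.exp (-(4 * Real.pi ^ 2 * ((n : ℝ) + 1) / (((c : ℝ) * Real.sqrt r) ^ 2 * p))) : ℝ) : ℂ)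
      with hTB
    set TA : ℂ := ∑' n : ℕ, lamA (n + 1) * ((𝐞 (((n : ℝ) + 1) * xA) : Circle) : ℂ) *
      ((Real.exp (-(p * ((n : ℝ) + 1))) : ℝ) : ℂ) with hTA
    rw [integral_exp_neg_mul_Ioi_complex hp, mul_zero, neg_zero, Real.exp_zero, Complex.ofReal_one,
      mul_one, hkey]
    push_cast
    field_simp
    ring

/-- **Proposition 3.1 at weight one for exponential polynomials** `f(x) = Σ_{k∈s} w_k e^{-p_k x}`,
`p_k > 0` (constant term `a₀f(0)` kept), by linearity from `voronoi_hasSum_exp`.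
[cite: ConreyIwaniec2002, Proposition 3.1 (3.11)] -/
theorem voronoi_hasSum_expPoly {c r : ℕ} (hc : 1 ≤ c) (hr : 1 ≤ r) {η : ℂ} {M : ℝ}
    {lamA lamB : ℕ → ℂ} (hA : ∀ n : ℕ, ‖lamA n‖ ≤ M * (Nat.divisors n).card)
    (hB : ∀ n : ℕ, ‖lamB n‖ ≤ M * (Nat.divisors n).card)
    {a₀ b₀ : ℂ} {xA xB : ℝ}
    (hrel : IsOmegaRelated ((c : ℝ) * Real.sqrt r) η lamA lamB a₀ b₀ xA xB)
    (s : Finset ℕ) (w : ℕ → ℂ) (ps : ℕ → ℝ) (hps : ∀ k ∈ s, 0 < ps k) :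
    HasSum
      (fun m : ℕ ↦ (2 * Real.pi * I * η / ((c : ℝ) * Real.sqrt r)) * lamB (m + 1) *
        ((𝐞 (((m : ℝ) + 1) * xB) : Circle) : ℂ) *
        ∫ x in Ioi (0 : ℝ), (∑ k ∈ s, w k * ((Real.exp (-(ps k * x)) : ℝ) : ℂ)) *
          ciBesselKernel (fun _ ↦ r) c (m + 1) x)
      (a₀ * (∑ k ∈ s, w k * ((Real.exp (-(ps k * 0)) : ℝ) : ℂ)) +
        (∑' n : ℕ, lamA (n + 1) * ((𝐞 (((n : ℝ) + 1) * xA) : Circle) : ℂ) *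
          (∑ k ∈ s, w k * ((Real.exp (-(ps k * ((n : ℝ) + 1))) : ℝ) : ℂ))) -
        (2 * Real.pi * I * η / ((c : ℝ) * Real.sqrt r)) * b₀ *
          ∫ x in Ioi (0 : ℝ), (∑ k ∈ s, w k * ((Real.exp (-(ps k * x)) : ℝ) : ℂ))) := by
  set κ : ℂ := 2 * Real.pi * I * η / ((c : ℝ) * Real.sqrt r) with hκ
  -- the single-exponential statements, with coefficients
  have hk : ∀ k ∈ s, HasSum
      (fun m : ℕ ↦ w k * (κ * lamB (m + 1) * ((𝐞 (((m : ℝ) + 1) * xB) : Circle) : ℂ) *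
        ∫ x in Ioi (0 : ℝ), ((Real.exp (-(ps k * x)) : ℝ) : ℂ) * ciBesselKernel (fun _ ↦ r) c (m + 1) x))
      (w k * (a₀ * ((Real.exp (-(ps k * 0)) : ℝ) : ℂ) +
        (∑' n : ℕ, lamA (n + 1) * ((𝐞 (((n : ℝ) + 1) * xA) : Circle) : ℂ) *
          ((Real.exp (-(ps k * ((n : ℝ) + 1))) : ℝ) : ℂ)) -
        κ * b₀ * ∫ x in Ioi (0 : ℝ), ((Real.exp (-(ps k * x)) : ℝ) : ℂ))) :=
    fun k hk => (voronoi_hasSum_exp hc hr hB hrel (hps k hk)).mul_left (w k)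
  have hS := hasSum_sum hk
  -- integrability / summability bookkeeping
  have hI0 : ∀ k ∈ s, Integrable (fun x : ℝ => w k * ((Real.exp (-(ps k * x)) : ℝ) : ℂ))
      (volume.restrict (Ioi 0)) :=
    fun k hk => (integrableOn_exp_neg_mul_Ioi_complex (hps k hk)).const_mul (w k)
  have hIK : ∀ m : ℕ, ∀ k ∈ s, Integrable (fun x : ℝ => w k * (((Real.exp (-(ps k * x)) : ℝ) : ℂ) *
      ciBesselKernel (fun _ ↦ r) c (m + 1) x)) (volume.restrict (Ioi 0)) :=
    fun m k hk => (integrableOn_exp_mul_ciBesselKernel r c (m + 1) (hps k hk)).const_mul (w k)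
  have hT : ∀ k ∈ s, Summable (fun n : ℕ => w k * (lamA (n + 1) *
      ((𝐞 (((n : ℝ) + 1) * xA) : Circle) : ℂ) * ((Real.exp (-(ps k * ((n : ℝ) + 1))) : ℝ) : ℂ))) :=
    fun k hk => (summable_twisted_exp hA xA (hps k hk)).mul_left (w k)
  convert hS using 1
  · funext m
    simp_rw [Finset.sum_mul]
    rw [integral_finsetSum _ (fun k hk => ?_), Finset.mul_sum]
    · refine Finset.sum_congr rfl fun k _ => ?_
      have hint : ∫ x in Ioi (0 : ℝ), w k * ((Real.exp (-(ps k * x)) : ℝ) : ℂ) *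
            ciBesselKernel (fun _ ↦ r) c (m + 1) x =
          w k * ∫ x in Ioi (0 : ℝ), ((Real.exp (-(ps k * x)) : ℝ) : ℂ) *
            ciBesselKernel (fun _ ↦ r) c (m + 1) x := by
        rw [← integral_const_mul]
        congr 1
        funext x
        ring
      rw [hint]
      ring
    · have := hIK m k hk
      refine this.congr (Filter.Eventually.of_forall fun x => ?_)
      ring
  · rw [integral_finsetSum _ hI0]
    have h2 : (∑' n : ℕ, lamA (n + 1) * ((𝐞 (((n : ℝ) + 1) * xA) : Circle) : ℂ) *
        (∑ k ∈ s, w k * ((Real.exp (-(ps k * ((n : ℝ) + 1))) : ℝ) : ℂ))) =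
        ∑ k ∈ s, ∑' n : ℕ, w k * (lamA (n + 1) * ((𝐞 (((n : ℝ) + 1) * xA) : Circle) : ℂ) *
          ((Real.exp (-(ps k * ((n : ℝ) + 1))) : ℝ) : ℂ)) := by
      rw [← Summable.tsum_finsetSum hT]
      refine tsum_congr fun n => ?_
      rw [Finset.mul_sum]
      refine Finset.sum_congr rfl fun k _ => ?_
      ring
    rw [h2, Finset.mul_sum, Finset.mul_sum, ← Finset.sum_add_distrib, ← Finset.sum_sub_distrib]
    refine Finset.sum_congr rfl fun k _ => ?_
    rw [integral_const_mul, tsum_mul_left]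
    ring

end ConreyIwaniec2002

end Literature.NumberTheory.LFunctions

end
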